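import Literature.MathematicalPhysics.QuantumFieldTheory.Balaban1983to89.B15Prop1TowerFlatOfNearFlat
import Literature.MathematicalPhysics.QuantumFieldTheory.Balaban1983to89.Node00.MultiScaleFibreChartB

/-!
# `Balaban1983to89.B15Prop1TowerFlatOfNearFlatB` — [Balaban1988Convergent] = «[III]», (1.3) p. 246, (2.2) p. 255, (2.10)–(2.13) pp. 256–257; [Balaban1984PropagatorsII] = «[II]», (2.3) p. 224
# (the BOND-level determining datum); [Balaban1989LargeFieldI] = «[IV]», (1.74) p. 192; [Balaban1985Averaging] = «[4]», (124) p. 36: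
# THE TOWER-FLATNESS ROW (δ_T) FROM THE `Ω₁`-FLATNESS ROW (δ) OVER A BOND DETERMINING SET `𝔅 : BDetSet P` — print-datum ([II] (2.3)) edition of the lane's `B15Prop1TowerFlatOfNearFlat`
# §2∕§3 (the two datum-bearing declarations N12's junction of record v14ᴸ uses through `AgreeOn`∕`constrEnum`: `norm_sub_one_le_towerBond_of_nearFlat_of_agreeOn`,
# `towerNearFlat_of_nearFlat_of_agreeOn_constr`) — class (γ)∕STRUCTURAL of dag-n12-c's census-by-declaration v2 (bus [DAGN12C-G35], 2026-08-30)

Honest framing: statement-level skeleton of published theorems with citation tags; proofs where landed; nothing here is a claim about the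
Yang–Mills mass gap.  Cell `pub-ymgap`, seat `pub-ymgap-dag-n12-c` (g35; LANE OWNER N12 = [B15], strategy s1); count-neutral helper of K1⁹ (`stmt-QuantumFields-27364`);
N12 NOT discharged; finite 𝕋⁴ at fixed ε; nothing continuum ∕ OS ∕ mass-gap ∕ Clay.

WHY A SEPARATE EDITION, AND WHAT CHANGES (the (E1)(iii-b) re-attachment, director-ym №338–№358).  The parent proves (δ_T) ⟸ (δ) for the tree's site-level determining set `𝐁_k(Z) =
Bj M₁ Z k`, reading its STRUCTURE twice: (i) a constrained bond `c ∈ bondsOf (𝐁_k(Z) j)` has an endpoint in `Γ_j ⊆ Ω_j(Z)^{(j)}` whose whole `j`-block lies in `Ω₁(Z)` (parent §1, kept: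
`mem_maxDomT_one_of_blockIter_eq_of_mem_Bj`); (ii) a fine bond with its SOURCE off `Ω₁(Z)` is a `Γ₀`-bond (`Bj_zero`: «a bond MEETS `Γ₀ = Ω₁ᶜ`»), pinned by the scale-`0` constraint.
Over print's [II] (2.3) BOND-level datum `𝔅` (`B15DeterminingSetsB.lamBondsSeq (maxDomT M₁ Z) k` = `B15Sect1Instances.lamDatumP k (maxDomT M₁ Z)`) both readings survive in the form the
proof actually needs: (i) because print's members are among the tree's (`lamBondsSeq_subset_bondsDet`: `𝔅 j ⊆ bondsOf (𝐁_k(Z) j)`), displayed here as the letter `h𝔅sub`; (ii) because the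
proof uses the pin only for a tower bond with BOTH endpoints off `Ω₁(Z)` — exactly print's scale-`0` members (`B15Prop1GradientFromNearValueB.mem_lamDatumP_maxDomT_zero_of_not_mem₂`),
displayed here as the letter `h𝔅0 : ∀ b, b₋ ∉ Ω₁(Z) → b₊ ∉ Ω₁(Z) → b ∈ 𝔅 0` (LOCATED-2 of the lane's census: the one-endpoint pin of `Bj_zero` is NOT available, and is NOT needed).
RE-KEY NOTE for the junction's generator (dag-n12-d): both theorems lose `hk0 : 0 < k` (it served `Bj_zero` only) and gain `(𝔅 : BDetSet P) (h𝔅sub) (h𝔅0)` right after `hdiv`; `hagree`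
reads `AgreeOnB 𝔅 …`; `hc : c ∈ 𝔅 j`; the enumerated edition runs over `Node00.constrEnumB 𝔅 k` (lane `Node00/MultiScaleFibreChartB`, ✓p774329).  At print's datum: `h𝔅sub :=
fun j => lamBondsSeq_subset_bondsDet (maxDomT ν.M₁ Z) k j`, `h𝔅0 := fun b hs ht => mem_lamDatumP_maxDomT_zero_of_not_mem₂ …`.

CONTENTS (theorems only; no `def`, no `instance`, no `sorry`; namespace `…B15Prop1TowerFlatOfNearFlatB`, SAME declaration names as the parent; the parent's datum-free §1 lemmas and the
plaquette device are used as they stand).  §2 ★★ `norm_sub_one_le_towerBond_of_nearFlat_of_agreeOn` (per tower bond, over `𝔅`); §3 ★★★ `towerNearFlat_of_nearFlat_of_agreeOn_constr`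
(`Node00.constrEnumB` currency).
HONEST SCOPE: block bookkeeping; (δ) itself remains a GAUGE letter; nothing of Bałaban's estimates asserted; count-neutral; N12 NOT discharged; the YM mass gap (Clay) is NOT proved by any
of this — R4 closes only the conditional finite-𝕋⁴ rung `BalabanLadder.UV`.
-/

noncomputable section

namespace Literature.MathematicalPhysics.QuantumFieldTheory.Balaban1983to89.B15Prop1TowerFlatOfNearFlatB

open B15Prop1TowerFlatOfNearFlat
open Literature.MathematicalPhysics.QuantumFieldTheory.Balaban1983to89.Node00 (SU ConstrSetB constrCardB constrEnumB)
open B15DeterminingSets B15DeterminingSetsB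
open B14.Eq213MaximalDomains (side)
open B14.Eq213DetSet (Bj Bj_mid Bj_top maxDomT maxDomT_antitone isBlockUnion_maxDomT)
open B14.Eq22Determines (blockIter blockIter_succ IsBlockUnion)
open B14.Eq216Concrete (qsstarGIter0_of_interior)
open B10Eq42TorusConstraint (bondsIn mem_bondsIn_iff)
open Literature.MathematicalPhysics.QuantumFieldTheory.BalabanImbrieJaffe1984to88.BIJ85Eq453GaugeField (qsstarGIter0)
open scoped Matrix.Norms.L2Operator

variable {P : Params}

/-! ## §2  Per tower bond, over a bond determining set -/

/-- ★★ **A TOWER BOND IS `δc`-FLAT — BOND-DATUM EDITION.**  OBJECTS: `Z`, `M₁ ≥ 1`, height `k ≤ m + K` with `s_k ∣ 2L^{m+K}`, ANY averaging family `av`, ANY scale-`k` base `W`, a BOND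
determining set `𝔅` whose members are among those of `𝐁_k(Z)` (`h𝔅sub`) and whose scale-`0` member contains every bond with BOTH endpoints off `Ω₁(Z)` (`h𝔅0`) — print's [II] (2.3)
datum at `Z`'s maximal sequence has both —, a configuration `U₀` with `M˙(U₀) = M˙(Q_k^{s*}W)` on `𝔅` ([III] (2.10)–(2.12)), and the row (δ): the four bonds of every plaquette meeting a bond
sourced in `Ω₁(Z)` are `δc`-flat for `U₀` (`0 ≤ δc`, `d ≥ 2`).  CONCLUSION: for `1 ≤ j ≤ k`, `c ∈ 𝔅 j` and every fine bond `b` of the tower region `blockIter j ⁻¹' {c₋, c₊}`,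
`‖U₀(b) − 1‖ ≤ δc`.  Proof: `b₋ ∈ Ω₁` or `b₊ ∈ Ω₁` ⇒ (δ) at a plaquette through `b` (parent's `exists_plaq_src_eq`); both off `Ω₁` ⇒ both in the non-`Γ_j` end's `j`-block (parent §1
via `h𝔅sub`) ⇒ one `k`-block ⇒ `(Q_k^{s*}W)(b) = 1` ([III] (1.3), `qsstarGIter0_of_interior`) and `b ∈ 𝔅 0` (`h𝔅0`) ⇒ the scale-`0` constraint reads `U₀(b) = 1`.
[cite: Balaban1988Convergent, (1.3) p.246, (2.2) p.255, (2.10)–(2.13) pp.256–257; Balaban1984PropagatorsII, (2.3) p.224; Balaban1989LargeFieldI, (1.74) p.192; Balaban1985Averaging, (124) p.36] -/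
theorem norm_sub_one_le_towerBond_of_nearFlat_of_agreeOn {N : ℕ} [NeZero N] {M₁ : ℕ} (hM : 1 ≤ M₁) (hd : 2 ≤ P.d)
    (Z : Set (Site P 0)) {k : ℕ} (hk : k ≤ P.m + P.K) (hdiv : side P.L M₁ k ∣ P.sitesPerDir 0)
    (𝔅 : BDetSet P) (h𝔅sub : ∀ j, 𝔅 j ⊆ bondsOf (Bj M₁ Z k j))
    (h𝔅0 : ∀ b : PBond P 0, b.src ∉ maxDomT M₁ Z 1 → b.tgt ∉ maxDomT M₁ Z 1 → b ∈ 𝔅 0)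
    (av : ∀ j, Averaging P j (SU N)) (W : GaugeField P k (SU N)) {U₀ : GaugeField P 0 (SU N)}
    (hagree : AgreeOnB 𝔅 (avgFamily av U₀) (avgFamily av (qsstarGIter0 k W)))
    {δc : ℝ} (hδc : 0 ≤ δc)
    (hNF : ∀ q : Plaq P 0, ((⟨q.src, q.μ⟩ : PBond P 0) ∈ {b : PBond P 0 | b.src ∈ maxDomT M₁ Z 1} ∨
        (⟨q.src.shift q.μ, q.ν⟩ : PBond P 0) ∈ {b : PBond P 0 | b.src ∈ maxDomT M₁ Z 1} ∨
        (⟨q.src.shift q.ν, q.μ⟩ : PBond P 0) ∈ {b : PBond P 0 | b.src ∈ maxDomT M₁ Z 1} ∨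
        (⟨q.src, q.ν⟩ : PBond P 0) ∈ {b : PBond P 0 | b.src ∈ maxDomT M₁ Z 1}) →
      ‖((U₀ ⟨q.src, q.μ⟩ : SU N) : Matrix (Fin N) (Fin N) ℂ) - 1‖ ≤ δc ∧ ‖((U₀ ⟨q.src.shift q.μ, q.ν⟩ : SU N) : Matrix (Fin N) (Fin N) ℂ) - 1‖ ≤ δc ∧
        ‖((U₀ ⟨q.src.shift q.ν, q.μ⟩ : SU N) : Matrix (Fin N) (Fin N) ℂ) - 1‖ ≤ δc ∧ ‖((U₀ ⟨q.src, q.ν⟩ : SU N) : Matrix (Fin N) (Fin N) ℂ) - 1‖ ≤ δc)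
    {j : ℕ} (hj1 : 1 ≤ j) (hjk : j ≤ k) {c : PBond P j} (hc : c ∈ 𝔅 j)
    {b : PBond P 0} (hb : b ∈ bondsIn 0 (blockIter j ⁻¹' ({c.src, c.tgt} : Set (Site P j)))) :
    ‖((U₀ b : SU N) : Matrix (Fin N) (Fin N) ℂ) - 1‖ ≤ δc := by
  obtain ⟨x, μ⟩ := b
  -- the tower region membership, read at scale `0` (`toFine 0 = id`)
  have hb' := (mem_bondsIn_iff.1 hb)
  simp only [B10Eq38TorusDomains.toFine_zero, Set.mem_preimage, Set.mem_insert_iff, Set.mem_singleton_iff] at hb'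
  obtain ⟨hsrc, htgt⟩ := hb'
  -- a plaquette through `b`
  obtain ⟨q, hqx, hqμ⟩ := exists_plaq_src_eq hd x μ
  by_cases hs : x ∈ maxDomT M₁ Z 1
  · -- `b₋ ∈ Ω₁`: `b` itself is an `Ω₁`-sourced bond of `q`
    rcases hqμ with hqμ | hqν
    · have h := (hNF q (Or.inl (by rw [Set.mem_setOf_eq, hqx]; exact hs))).1
      rwa [hqx, hqμ] at h
    · have h := (hNF q (Or.inr (Or.inr (Or.inr (by rw [Set.mem_setOf_eq, hqx]; exact hs))))).2.2.2
      rwa [hqx, hqν] at h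
  by_cases ht : x.shift μ ∈ maxDomT M₁ Z 1
  · -- `b₊ ∈ Ω₁`: the bond of `q` leaving `b₊` is `Ω₁`-sourced
    rcases hqμ with hqμ | hqν
    · have h := (hNF q (Or.inr (Or.inl (by rw [Set.mem_setOf_eq, hqx, hqμ]; exact ht)))).1
      rwa [hqx, hqμ] at h
    · have h := (hNF q (Or.inr (Or.inr (Or.inl (by rw [Set.mem_setOf_eq, hqx, hqν]; exact ht))))).2.2.2
      rwa [hqx, hqν] at h
  -- both ends off `Ω₁`: they lie in the non-`Γ_j` end's `j`-block, hence in one `k`-block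
  have hc' : c ∈ bondsOf (Bj M₁ Z k j) := h𝔅sub j hc
  have key : ∀ {y₀ : Site P j}, y₀ ∈ Bj M₁ Z k j → ∀ z : Site P 0, blockIter j z = y₀ → z ∈ maxDomT M₁ Z 1 :=
    fun hy₀ z hz => mem_maxDomT_one_of_blockIter_eq_of_mem_Bj hM Z hk hdiv hj1 hjk hy₀ hz
  have hblk : blockIter j x = blockIter j (x.shift μ) := by
    rcases hc' with hc' | hc'
    · have hs' : blockIter j x = c.tgt := hsrc.resolve_left fun h => hs (key hc' _ h)
      have ht' : blockIter j (x.shift μ) = c.tgt := htgt.resolve_left fun h => ht (key hc' _ h)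
      rw [hs', ht']
    · have hs' : blockIter j x = c.src := hsrc.resolve_right fun h => hs (key hc' _ h)
      have ht' : blockIter j (x.shift μ) = c.src := htgt.resolve_right fun h => ht (key hc' _ h)
      rw [hs', ht']
  have hblkk : blockIter k (⟨x, μ⟩ : PBond P 0).src = blockIter k (⟨x, μ⟩ : PBond P 0).tgt :=
    blockIter_eq_of_blockIter_eq_of_le hjk hblk
  have hQ : qsstarGIter0 k W ⟨x, μ⟩ = 1 := qsstarGIter0_of_interior hk W hblkk
  -- the scale-`0` constraint on print's scale-`0` members: both endpoints off `Ω₁`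
  have hb0 : (⟨x, μ⟩ : PBond P 0) ∈ 𝔅 0 := h𝔅0 _ hs ht
  have hU : U₀ ⟨x, μ⟩ = qsstarGIter0 k W ⟨x, μ⟩ := hagree 0 _ hb0
  rw [hU, hQ]
  simpa using hδc

/-! ## §3  Enumerated: the producer's (δ_T) row from its (δ) row, `Node00.constrEnumB` currency -/

/-- ★★★ **THE TOWER-FLATNESS ROW (δ_T) FROM THE `Ω₁`-FLATNESS ROW (δ) AND THE CONSTRAINT, ENUMERATED — BOND-DATUM EDITION** (`Node00.constrEnumB` currency, the index of the bond-datum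
coordinates `msChartB`): under the objects and rows of §2, for every `i : Fin (constrCardB 𝔅 k)` of POSITIVE level `j_i` and every fine bond `b` of the tower region `blockIter j_i ⁻¹'
{(c_i)₋, (c_i)₊}`, `‖U₀(b) − 1‖ ≤ δc` — the (J0′) producer's (δ_T) row VERBATIM with `δT := δc`.
[cite: Balaban1988Convergent, (1.3) p.246, (2.2) p.255, (2.10)–(2.13) pp.256–257; Balaban1984PropagatorsII, (2.3) p.224; Balaban1989LargeFieldI, (1.74) p.192; Balaban1985Averaging, (124) p.36] -/
theorem towerNearFlat_of_nearFlat_of_agreeOn_constr {N : ℕ} [NeZero N] {M₁ : ℕ} (hM : 1 ≤ M₁) (hd : 2 ≤ P.d)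
    (Z : Set (Site P 0)) {k : ℕ} (hk : k ≤ P.m + P.K) (hdiv : side P.L M₁ k ∣ P.sitesPerDir 0)
    (𝔅 : BDetSet P) (h𝔅sub : ∀ j, 𝔅 j ⊆ bondsOf (Bj M₁ Z k j))
    (h𝔅0 : ∀ b : PBond P 0, b.src ∉ maxDomT M₁ Z 1 → b.tgt ∉ maxDomT M₁ Z 1 → b ∈ 𝔅 0)
    (av : ∀ j, Averaging P j (SU N)) (W : GaugeField P k (SU N)) {U₀ : GaugeField P 0 (SU N)}
    (hagree : AgreeOnB 𝔅 (avgFamily av U₀) (avgFamily av (qsstarGIter0 k W)))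
    {δc : ℝ} (hδc : 0 ≤ δc)
    (hNF : ∀ q : Plaq P 0, ((⟨q.src, q.μ⟩ : PBond P 0) ∈ {b : PBond P 0 | b.src ∈ maxDomT M₁ Z 1} ∨
        (⟨q.src.shift q.μ, q.ν⟩ : PBond P 0) ∈ {b : PBond P 0 | b.src ∈ maxDomT M₁ Z 1} ∨
        (⟨q.src.shift q.ν, q.μ⟩ : PBond P 0) ∈ {b : PBond P 0 | b.src ∈ maxDomT M₁ Z 1} ∨
        (⟨q.src, q.ν⟩ : PBond P 0) ∈ {b : PBond P 0 | b.src ∈ maxDomT M₁ Z 1}) →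
      ‖((U₀ ⟨q.src, q.μ⟩ : SU N) : Matrix (Fin N) (Fin N) ℂ) - 1‖ ≤ δc ∧ ‖((U₀ ⟨q.src.shift q.μ, q.ν⟩ : SU N) : Matrix (Fin N) (Fin N) ℂ) - 1‖ ≤ δc ∧
        ‖((U₀ ⟨q.src.shift q.ν, q.μ⟩ : SU N) : Matrix (Fin N) (Fin N) ℂ) - 1‖ ≤ δc ∧ ‖((U₀ ⟨q.src, q.ν⟩ : SU N) : Matrix (Fin N) (Fin N) ℂ) - 1‖ ≤ δc) :
    ∀ i : Fin (constrCardB 𝔅 k), 0 < (((constrEnumB 𝔅 k).symm i).1 : ℕ) →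
      ∀ b : PBond P 0, b ∈ bondsIn 0 (blockIter (((constrEnumB 𝔅 k).symm i).1 : ℕ) ⁻¹'
        ({((constrEnumB 𝔅 k).symm i).2.1.src, ((constrEnumB 𝔅 k).symm i).2.1.tgt} :
          Set (Site P ((constrEnumB 𝔅 k).symm i).1))) →
        ‖((U₀ b : SU N) : Matrix (Fin N) (Fin N) ℂ) - 1‖ ≤ δc := by
  intro i hi b hb
  exact norm_sub_one_le_towerBond_of_nearFlat_of_agreeOn hM hd Z hk hdiv 𝔅 h𝔅sub h𝔅0 av W hagree hδc hNF hi
    (Nat.lt_succ_iff.1 ((constrEnumB 𝔅 k).symm i).1.2) ((constrEnumB 𝔅 k).symm i).2.2 hb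

end Literature.MathematicalPhysics.QuantumFieldTheory.Balaban1983to89.B15Prop1TowerFlatOfNearFlatB

end
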